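import Summits.CriticalPhenomena.PercolationContinuityZ3.Theorems.PercNearOneGluingNoHeavyQuantTwinMoveTransferFacts
import Summits.CriticalPhenomena.PercolationContinuityZ3.Theorems.PercNearOneGluingNoHeavyQuantFlowPourFrom
import HarnessLib

/-!
# QUANT lane R8, T-DEC, leg (III): TWIN MOVE, THE FIRST POUR — the lows `l ≥ a` refill the vacated fraction of the blob atom's mid slots
# (`twinMove_refillPour`): a routing of `P`'s nonzero lows whose mid columns still leave the zero's slots free and whose giant mass is at most
# `Σ_l G_f(l) − G_f(0) − zg`

builds on p205010 (kernel theorem, internal audit signed; external expert review pending)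

Support file (`--supports stmt-CriticalPhenomena-4575`), QUANT lane seat prim-quant-arm-1 (gen 39), rung R8 of
`run/shared/lean/prim/quant/LADDER.md`.  Theorems only (no definitions), standard axioms, no sorries.  Step 1 of the two-pour competitor
(memo TWIN-MOVE-G39 §9–§10): `twinMove_transferFacts` + `IsFlowAtT.pourFrom` with `good l := a ≤ l`, slots = the mids `h ≤ j` with `f a h > 0`,
spare `(1 − θ)·usage_τ(a,h)·f a h`, rate bound `usage_τ(a,h)` (`rho_le_rho_of_le_low`), `θ = P a/Λ a`.  HYPOTHESIS: the transfer's giant mass on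
the lows `≥ a` is at least `(1−θ)·Σ_{h ≤ j} f a h`.  OUTPUT: a flow witness `φ₁` of `P⁰` at `(y, t, j, N)` with
(a) `load_t(φ₁, h) + usage_τ(0,h)·f 0 h ≤ load_τ(f, h)` at every non-giant `h` (the zero's slots are still vacated), and
(b) `Σ_l Σ_giants φ₁ l g ≤ Σ_{l ≤ j} G_f(l) − G_f(0) − zg` (`G_f(l)` = `f`'s giant mass of `l`).  Step 2: `…QuantTwinMoveVacatedRefill`.

* **`LawDec.twinMove_refillPour`**.

[this work]; nothing here is cited as a published result.  The gluing rows served [cite: KozmaNitzan2024, Conjecture 3 (p. 15)]; product measure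
[cite: Grimmett1999, §1.3 p. 10].
-/

noncomputable section

namespace Summit.CriticalPhenomena.PercolationContinuityZ3.Theorems

namespace Quant

open Finset

/-- the two-point law `{lo, hi; g}` (as in `…QuantLawDEC`) -/
local notation3 "TP[" lo ", " hi ", " g ", " h "]" =>
  (g : ℝ) * (if (h : ℕ) = (hi : ℕ) then (1 : ℝ) else 0) + (1 - (g : ℝ)) * (if (h : ℕ) = (lo : ℕ) then (1 : ℝ) else 0)

namespace LawDec

set_option maxHeartbeats 400000 in
/-- **TWIN MOVE, THE FIRST POUR.**  See the module docstring. [this work] -/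
theorem twinMove_refillPour (y z g : ℝ) (a j N : ℕ) (R : ℕ → ℝ) (f : ℕ → ℕ → ℝ)
    (hy0 : 0 < y) (hy1 : y < 1) (hz0 : 0 ≤ z) (hz1 : z < 1) (hg0 : 0 < g) (hg1 : g ≤ 1) (ha1 : 1 ≤ a)
    (hR0 : ∀ h, 0 ≤ R h)
    (hat : 2 * (a : ℝ) < (1 - z) * ∑ h ∈ Finset.range (N + 1), (h : ℝ) * R h) (haj : a ≤ j)
    (hf : IsFlowAtT y (z * (a : ℝ) * g + (1 - z) * ∑ h ∈ Finset.range (N + 1), (h : ℝ) * R h) j N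
      (fun h => z * TP[0, a, g, h] + (1 - z) * R h) f)
    (hbig : (1 - ((1 - z) * R a) / (z * g + (1 - z) * R a)) * ∑ h ∈ Finset.range (N + 1), (if h ≤ j then f a h else 0)
      ≤ ∑ l ∈ Finset.range (j + 1), (if a ≤ l then ∑ g' ∈ Finset.Ico (j + 1) (N + 1),
          (if (1 ≤ l ∧ 2 * (l : ℝ) < (1 - z) * ∑ h ∈ Finset.range (N + 1), (h : ℝ) * R h) then
            (z * (if l = 0 then (1 : ℝ) else 0) + (1 - z) * R l) / (z * TP[0, a, g, l] + (1 - z) * R l) * f l g' else 0) else 0)) :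
    ∃ φ₁ : ℕ → ℕ → ℝ,
      IsFlowAtT y ((1 - z) * ∑ h ∈ Finset.range (N + 1), (h : ℝ) * R h) j N
        (fun h => if h = 0 then 0 else (z * (if h = 0 then (1 : ℝ) else 0) + (1 - z) * R h)) φ₁ ∧
      (∀ h, ¬ (j + 1 ≤ h) →
        ∑ l ∈ Finset.range (j + 1), usage y ((1 - z) * ∑ h ∈ Finset.range (N + 1), (h : ℝ) * R h) j l h * φ₁ l h
          + usage y (z * (a : ℝ) * g + (1 - z) * ∑ h ∈ Finset.range (N + 1), (h : ℝ) * R h) j 0 h * f 0 h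
        ≤ ∑ l ∈ Finset.range (j + 1), usage y (z * (a : ℝ) * g + (1 - z) * ∑ h ∈ Finset.range (N + 1), (h : ℝ) * R h) j l h * f l h) ∧
      (∑ l ∈ Finset.range (j + 1), ∑ g' ∈ Finset.Ico (j + 1) (N + 1), φ₁ l g'
        ≤ (∑ l ∈ Finset.range (j + 1), ∑ g' ∈ Finset.Ico (j + 1) (N + 1), f l g')
          - (∑ g' ∈ Finset.Ico (j + 1) (N + 1), f 0 g') - z * g) := by
  classical
  obtain ⟨hφP0, hsharpcol, hcolΛ, hφle, hφa, hφzero, hθ0, hθ1, hPΛa⟩ :=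
    twinMove_transferFacts y z g a j N R f hy0 hy1 hz0 hz1 hg0 hg1 ha1 hR0 hat haj hf
  set S : ℝ := ∑ h ∈ Finset.range (N + 1), (h : ℝ) * R h with hS
  set t : ℝ := (1 - z) * S with ht
  set τ : ℝ := z * (a : ℝ) * g + (1 - z) * S with hτ
  set Λ : ℕ → ℝ := fun h => z * TP[0, a, g, h] + (1 - z) * R h with hΛ
  set P : ℕ → ℝ := fun h => z * (if h = 0 then (1 : ℝ) else 0) + (1 - z) * R h with hP
  set φ : ℕ → ℕ → ℝ := fun l h => if (1 ≤ l ∧ 2 * (l : ℝ) < t) then P l / Λ l * f l h else 0 with hφ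
  set θ : ℝ := P a / Λ a with hθdef
  have h1z : 0 < 1 - z := by linarith
  have ha0 : (0 : ℝ) ≤ a := Nat.cast_nonneg a
  have hane : a ≠ 0 := by omega
  have hzg : 0 ≤ z * g := mul_nonneg hz0 hg0.le
  have hzag : 0 ≤ z * (a : ℝ) * g := mul_nonneg (mul_nonneg hz0 ha0) hg0.le
  have htτ : t ≤ τ := by rw [ht, hτ]; linarith
  have ht0 : 0 < t := by rw [ht]; nlinarith
  have hτ0 : 0 < τ := lt_of_lt_of_le ht0 htτ
  obtain ⟨hf0, hfsupp, hfrow, hfcol⟩ := id hf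
  have hP0 : ∀ h, 0 ≤ P h := fun h => by simp only [hP]; split_ifs <;> nlinarith [hR0 h]
  have hΛa : Λ a = z * g + (1 - z) * R a := by
    show z * (g * (if a = a then (1:ℝ) else 0) + (1 - g) * (if a = 0 then (1:ℝ) else 0)) + (1 - z) * R a = _
    rw [if_pos rfl, if_neg hane]; ring
  have hPa : P a = (1 - z) * R a := by
    show z * (if a = 0 then (1:ℝ) else 0) + (1 - z) * R a = _
    rw [if_neg hane]; ring
  have hbig' : (1 - θ) * ∑ h ∈ Finset.range (N + 1), (if h ≤ j then f a h else 0)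
      ≤ ∑ l ∈ Finset.range (j + 1), (if a ≤ l then ∑ g' ∈ Finset.Ico (j + 1) (N + 1), φ l g' else 0) := by
    have e : θ = ((1 - z) * R a) / (z * g + (1 - z) * R a) := by rw [hθdef, hPa, hΛa]
    rw [e]; exact hbig
  have hpair : ∀ l h, 0 < f l h → l ≤ j ∧ 2 * (l : ℝ) < τ ∧ h ≤ N ∧ (j + 1 ≤ h ∨ τ < (l : ℝ) + h) ∧ l < h := by
    intro l h hp
    obtain ⟨hlj, hl2, hhM, hc⟩ := hfsupp l h hp
    refine ⟨hlj, hl2, hhM, hc, ?_⟩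
    rcases hc with hc | hc
    · omega
    · have : (l : ℝ) < h := by linarith
      exact_mod_cast this
  -- the blob atom's mid slots
  have haslot : ∀ h, h ≤ j → 0 < f a h → h ≤ N ∧ τ < (a : ℝ) + h ∧ τ ≤ 2 * (h : ℝ) ∧ a < h ∧ 0 < usage y τ j a h := by
    intro h hhj hp
    obtain ⟨_, hl2, hhN, hc, hlh⟩ := hpair a h hp
    have hc' : τ < (a : ℝ) + h := by
      rcases hc with hc | hc
      · omega
      · exact hc
    exact ⟨hhN, hc', by linarith, hlh, usage_pos_of_compat y τ j a h hy0 hy1 hl2 hlh (Or.inr hc')⟩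
  set s1 : ℕ → ℝ := fun h => if (h ≤ j ∧ 0 < f a h) then (1 - θ) * (usage y τ j a h * f a h) else 0 with hs1
  set U1 : ℕ → ℝ := fun h => if (h ≤ j ∧ 0 < f a h) then usage y τ j a h else 1 with hU1
  have hs10 : ∀ h, 0 ≤ s1 h := fun h => by
    simp only [hs1]; split_ifs with hc
    · exact mul_nonneg (by linarith) (mul_nonneg (haslot h hc.1 hc.2).2.2.2.2.le hc.2.le)
    · exact le_rfl
  have hU1p : ∀ h, 0 < U1 h := fun h => by
    simp only [hU1]; split_ifs with hc
    · exact (haslot h hc.1 hc.2).2.2.2.2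
    · exact zero_lt_one
  have hs1g : ∀ h, 0 < s1 h → h ≤ j ∧ 0 < f a h := by
    intro h hp; simp only [hs1] at hp; by_contra hc; rw [if_neg hc] at hp; exact lt_irrefl _ hp
  have hs1le : ∀ h, h ≤ j → s1 h ≤ (1 - θ) * (usage y τ j a h * f a h) := by
    intro h hhj
    simp only [hs1]; split_ifs with hc
    · exact le_rfl
    · refine mul_nonneg (by linarith) ?_
      rcases (hf0 a h).eq_or_lt with hz | hpa
      · rw [← hz, mul_zero]
      · exact mul_nonneg (haslot h hhj hpa).2.2.2.2.le hpa.le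
  have hslot1 : ∀ h, 0 < s1 h → h ≤ j ∧ h ≤ N ∧ t ≤ 2 * (h : ℝ) := by
    intro h hp
    obtain ⟨hhj, hfa⟩ := hs1g h hp
    obtain ⟨hhN, _, hτ2h, _, _⟩ := haslot h hhj hfa
    exact ⟨hhj, hhN, htτ.trans hτ2h⟩
  have hcompat1 : ∀ l h, 0 < s1 h → a ≤ l → l ≤ j → 2 * (l : ℝ) < t → t < (l : ℝ) + h := by
    intro l h hp hal _ _
    obtain ⟨hhj, hfa⟩ := hs1g h hp
    obtain ⟨_, hc, _, _, _⟩ := haslot h hhj hfa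
    have : (a : ℝ) ≤ l := by exact_mod_cast hal
    linarith
  have hu0f0 : ∀ h, 0 ≤ usage y τ j 0 h * f 0 h := by
    intro h
    rcases (hf0 0 h).eq_or_lt with hz | hp0
    · rw [← hz, mul_zero]
    · obtain ⟨_, hl2, _, hc, hlh⟩ := hpair 0 h hp0
      exact mul_nonneg (usage_pos_of_compat y τ j 0 h hy0 hy1 hl2 hlh hc).le hp0.le
  have hspare1 : ∀ h, 0 < s1 h → ∑ l ∈ Finset.range (j + 1), usage y t j l h * φ l h + s1 h ≤ (fun h => if h = 0 then 0 else P h) h := by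
    intro h hp
    obtain ⟨hhj, hfa⟩ := hs1g h hp
    obtain ⟨hhN, _, hτ2h, hah, _⟩ := haslot h hhj hfa
    obtain ⟨hc1, hc2⟩ := hcolΛ h hhN (Or.inr (htτ.trans hτ2h))
    have hsh := hsharpcol h (by omega)
    have hh0 : h ≠ 0 := by omega
    show _ ≤ (if h = 0 then 0 else P h)
    rw [if_neg hh0, ← hc2]
    linarith [hs1le h hhj, hu0f0 h]
  have hrate1 : ∀ l h, 0 < s1 h → a ≤ l → l ≤ j → 2 * (l : ℝ) < t → usage y t j l h ≤ U1 h := by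
    intro l h hp hal _ _
    obtain ⟨hhj, hfa⟩ := hs1g h hp
    obtain ⟨_, hc, hτ2h, hah, _⟩ := haslot h hhj hfa
    have hUv : U1 h = usage y τ j a h := by simp only [hU1, if_pos (And.intro hhj hfa)]
    rw [hUv]
    have hal' : (a : ℝ) ≤ l := by exact_mod_cast hal
    have hlh : l < h := by
      have h2a : 2 * (a : ℝ) < τ := by linarith
      have : (l : ℝ) < h := by nlinarith
      exact_mod_cast this
    exact usage_le_of_rho_le y t τ j l a h hy0 hy1 hhj (by linarith) hc (rho_le_rho_of_le_low t τ a l h htτ hal hlh hτ2h)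
  -- `F1 = (1−θ)·Fa ≤ Wbig`
  set Fa : ℝ := ∑ h ∈ Finset.range (N + 1), (if h ≤ j then f a h else 0) with hFa
  have hFa0 : 0 ≤ Fa := Finset.sum_nonneg fun h _ => by split_ifs; exacts [hf0 a h, le_rfl]
  have hF1v : ∑ h ∈ Finset.range (N + 1), s1 h / U1 h = (1 - θ) * Fa := by
    rw [hFa, Finset.mul_sum]
    refine Finset.sum_congr rfl fun h _ => ?_
    simp only [hs1, hU1]
    by_cases hc : (h ≤ j ∧ 0 < f a h)
    · rw [if_pos hc, if_pos hc, if_pos hc.1]; field_simp [(haslot h hc.1 hc.2).2.2.2.2.ne']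
    · rw [if_neg hc, if_neg hc, zero_div]
      by_cases hhj : h ≤ j
      · rw [if_pos hhj]
        have : f a h = 0 := le_antisymm (not_lt.1 fun hp => hc ⟨hhj, hp⟩) (hf0 a h)
        rw [this, mul_zero]
      · rw [if_neg hhj, mul_zero]
  set Wbig : ℝ := ∑ l ∈ Finset.range (j + 1), (if a ≤ l then ∑ g' ∈ Finset.Ico (j + 1) (N + 1), φ l g' else 0) with hWbig
  have hWbig0 : 0 ≤ Wbig := Finset.sum_nonneg fun l _ => by
    split_ifs; exacts [Finset.sum_nonneg fun g' _ => hφP0.1 l g', le_rfl]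
  have hF10 : 0 ≤ (1 - θ) * Fa := mul_nonneg (by linarith) hFa0
  have hF1le : (1 - θ) * Fa ≤ Wbig := hbig'
  set κ1 : ℝ := if Wbig = 0 then 0 else (1 - θ) * Fa / Wbig with hκ1
  have hκ10 : 0 ≤ κ1 := by simp only [hκ1]; split_ifs; exacts [le_rfl, div_nonneg hF10 hWbig0]
  have hκ11 : κ1 ≤ 1 := by
    simp only [hκ1]; split_ifs with hc
    · exact zero_le_one
    · exact (div_le_one (lt_of_le_of_ne hWbig0 (Ne.symm hc))).2 hF1le
  have hκ1W : κ1 * Wbig = (1 - θ) * Fa := by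
    simp only [hκ1]; split_ifs with hc
    · rw [zero_mul]; rw [hc] at hF1le; linarith
    · exact div_mul_cancel₀ _ hc
  obtain ⟨hφ1, hload1⟩ := hφP0.pourFrom hy0 hy1 (fun l => a ≤ l) s1 U1 hs10 hU1p hslot1 hcompat1 hspare1 hrate1 κ1 hκ10 hκ11
    (by rw [hκ1W, hF1v])
  refine ⟨_, hφ1, fun h hg => ?_, ?_⟩
  · -- (a) the zero's slots are still free
    have hl1 := hload1 h hg
    have hsh := hsharpcol h hg
    have hs1h := hs1le h (by omega)
    linarith
  · -- (b) the giant mass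
    set Gf : ℕ → ℝ := fun l => ∑ g' ∈ Finset.Ico (j + 1) (N + 1), f l g' with hGf
    -- giant mass after the pour = transfer's giant mass − κ1·Wbig
    have hW1 : ∑ l ∈ Finset.range (j + 1), ∑ g' ∈ Finset.Ico (j + 1) (N + 1),
        (fun l h => if j + 1 ≤ h then (1 - (if a ≤ l then κ1 else 0)) * φ l h
          else φ l h + (if a ≤ l then κ1 else 0) * (∑ g'' ∈ Finset.Ico (j + 1) (N + 1), φ l g'') * (s1 h / U1 h)
            / (∑ h' ∈ Finset.range (N + 1), s1 h' / U1 h')) l g'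
        = (∑ l ∈ Finset.range (j + 1), ∑ g' ∈ Finset.Ico (j + 1) (N + 1), φ l g') - (1 - θ) * Fa := by
      rw [← hκ1W, hWbig, Finset.mul_sum, ← Finset.sum_sub_distrib]
      refine Finset.sum_congr rfl fun l _ => ?_
      have e : ∀ g' ∈ Finset.Ico (j + 1) (N + 1),
          (fun l h => if j + 1 ≤ h then (1 - (if a ≤ l then κ1 else 0)) * φ l h
            else φ l h + (if a ≤ l then κ1 else 0) * (∑ g'' ∈ Finset.Ico (j + 1) (N + 1), φ l g'') * (s1 h / U1 h)
              / (∑ h' ∈ Finset.range (N + 1), s1 h' / U1 h')) l g'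
          = φ l g' - (if a ≤ l then κ1 else 0) * φ l g' := by
        intro g' hg'
        show (if j + 1 ≤ g' then _ else _) = _
        rw [if_pos (Finset.mem_Ico.1 hg').1]; ring
      rw [Finset.sum_congr rfl e, Finset.sum_sub_distrib, ← Finset.mul_sum]
      split_ifs <;> ring
    rw [hW1]
    -- transfer's giant mass ≤ Σ Gf − Gf 0 − (1−θ)·Gf a, and `(1−θ)(Fa + Gf a) = (1−θ)Λ a = zg`
    have hrowb : ∀ l ∈ Finset.range (j + 1), ∑ g' ∈ Finset.Ico (j + 1) (N + 1), φ l g'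
        ≤ Gf l - (if l = 0 then Gf 0 else 0) - (if l = a then (1 - θ) * Gf a else 0) := by
      intro l _
      by_cases hl0 : l = 0
      · subst hl0
        rw [if_pos rfl, if_neg (Ne.symm hane), Finset.sum_eq_zero (fun g' _ => hφzero g')]; ring_nf; exact le_rfl
      · rw [if_neg hl0]
        by_cases hla : l = a
        · subst hla
          rw [if_pos rfl, sub_zero, hGf, Finset.mul_sum, ← Finset.sum_sub_distrib]
          refine Finset.sum_le_sum fun g' _ => ?_
          rw [hφa g']; ring_nf; exact le_rfl
        · rw [if_neg hla, sub_zero, sub_zero, hGf]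
          exact Finset.sum_le_sum fun g' hg' => hφle l g' (Finset.mem_Ico.1 hg').1 hla
    have hWtr : ∑ l ∈ Finset.range (j + 1), ∑ g' ∈ Finset.Ico (j + 1) (N + 1), φ l g'
        ≤ (∑ l ∈ Finset.range (j + 1), Gf l) - Gf 0 - (1 - θ) * Gf a := by
      calc _ ≤ ∑ l ∈ Finset.range (j + 1), (Gf l - (if l = 0 then Gf 0 else 0) - (if l = a then (1 - θ) * Gf a else 0)) :=
            Finset.sum_le_sum hrowb
        _ = (∑ l ∈ Finset.range (j + 1), Gf l) - Gf 0 - (1 - θ) * Gf a := by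
            have e1 : ∑ l ∈ Finset.range (j + 1), (if l = 0 then Gf 0 else 0) = Gf 0 := by
              rw [Finset.sum_eq_single_of_mem 0 (Finset.mem_range.2 (Nat.succ_pos j)) (fun l _ hl => if_neg hl), if_pos rfl]
            have e2 : ∑ l ∈ Finset.range (j + 1), (if l = a then (1 - θ) * Gf a else 0) = (1 - θ) * Gf a := by
              rw [Finset.sum_eq_single_of_mem a (Finset.mem_range.2 (by omega)) (fun l _ hl => if_neg hl), if_pos rfl]
            rw [Finset.sum_sub_distrib, Finset.sum_sub_distrib, e1, e2]
    -- `Fa + Gf a = Λ a` (the row of `a`) and `(1−θ)Λ a = zg`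
    have harow : Λ a = Fa + Gf a := by
      have hGfr : Gf a = ∑ h ∈ Finset.range (N + 1), (if j + 1 ≤ h then f a h else 0) := by
        simp only [hGf]; rw [sum_range_ite_ge_eq_Ico]
      rw [hGfr, hFa, ← Finset.sum_add_distrib, ← hfrow a haj (by linarith)]
      refine Finset.sum_congr rfl fun h _ => ?_
      by_cases hhj : h ≤ j
      · rw [if_pos hhj, if_neg (by omega), add_zero]
      · rw [if_neg hhj, if_pos (by omega), zero_add]
    have hθΛ : (1 - θ) * Λ a = z * g := by
      rw [hθdef]
      rcases (show 0 ≤ Λ a by rw [hΛa]; nlinarith [hR0 a]).eq_or_lt with hz | hp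
      · have hX : 0 ≤ (1 - z) * R a := mul_nonneg h1z.le (hR0 a)
        have : z * g = 0 := le_antisymm (by linarith [hΛa]) hzg
        rw [← hz, this]; simp
      · field_simp; linarith [hPΛa]
    have hsum : (1 - θ) * Fa + (1 - θ) * Gf a = z * g := by rw [← mul_add, ← harow, hθΛ]
    have hG0 : Gf 0 = ∑ g' ∈ Finset.Ico (j + 1) (N + 1), f 0 g' := rfl
    show _ ≤ (∑ l ∈ Finset.range (j + 1), Gf l) - Gf 0 - z * g
    linarith

end LawDec

end Quant

end Summit.CriticalPhenomena.PercolationContinuityZ3.Theorems
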